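import Summits.Ventures.CertifiedManyBodySolver.Downfold.PhaseMapCellScore
import Summits.Ventures.CertifiedManyBodySolver.Downfold.PhaseMapTablePooling
import Summits.Ventures.CertifiedManyBodySolver.Downfold.PhaseMapRungOneVerdict
import HarnessLib

/-!
# accuracy(certified) «must be 1.00»: it reads NA or exactly 1.00, or the run is FAIL — never a number below one

Venture CertifiedManyBodySolver, cell `pub/hubbard-downfold`, seat hubbard-downfold-score-1 (second scoring engine);
namespace `Summit.Ventures.CertifiedManyBodySolver.Downfold.CellScore`. ACCEPTANCE §4.3 («certified cells are expected to be few and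
never wrong»), §4.7 («accuracy(certified) [must be 1.00]»), §4.1 H1 (a certified cell word contradicting truth outside tolerance ⇒ the
map's run verdict is FAIL(certified-contradiction)), §7 v1.3 NA rule (accuracy(certified) NA = zero certified decided cells is
NON-BLOCKING ⇒ PASS(vacuous)). REUSES `CellScore.outcome`/`Word`/`Truth` (PhaseMapCellScore p463097), `Tally`/`meets`/`applicable`
(PhaseMapTablePooling p478346) and `rung1`/`rung1_eq_FAIL_iff` (PhaseMapRungOneVerdict p476819) by import. Everything is PROVED.

WHAT THIS IS NOT: a statement about any cell of any map. It is the KERNEL REFERENCE for how three rules interlock: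

* §1 `Conf` (certified | screening | extrapolated), `ScoredCell` = (class, word, truth) with `out := outcome word truth`;
  per-class accuracy tally `acc c cells` = agreeing / decided-and-truth-known cells of class `c` (abstain and unscored cells enter
  neither numerator nor denominator — «undetermined is counted, never scored as a miss»); the cell-level incident flag `h1 cells`
  (some CERTIFIED cell disagrees).
* §2 `acc_certified_meets_one_iff`: the certified accuracy tally meets 1 iff `h1 = false`; `acc_certified_applicable_false_iff`: it
  is NA iff no certified cell is decided against known truth.
* §3 THE INTERLOCK `rung1_eq_FAIL_of_h1` (an incident makes the §7 verdict FAIL whatever the clause table says) and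
  `acc_certified_of_ne_FAIL`: in every run whose verdict is NOT FAIL, accuracy(certified) is either NA or meets 1.00 — so the number
  «accuracy(certified) = 0.9» can never appear on a verdict line other than FAIL; the clause is binary by construction, which is why
  v1.3 could make its NA non-blocking without weakening anything.
* §4 contrast: screening-grade accuracy is an ordinary ratio — a screening disagreement lowers it without any incident
  (`screening_disagree_no_incident`), and abstentions never move any accuracy tally (`acc_cons_undetermined`).
* §5 numbers of record (run #6 = maps run-2026-08-27a, v1 table, both engines): certified decided cells 0 ⇒ accuracy(certified) NA
  (the «acc cert n/a (n 0)» print; PASS(vacuous) component), screening-grade 57 agreeing of 57 ⇒ meets 0.80, H1 0.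
-/

namespace Summit.Ventures.CertifiedManyBodySolver.Downfold

namespace CellScore

/-! ## §1 Classes, scored cells, per-class accuracy tallies, the incident flag -/

/-- The three confidence classes of a decided cell word (§3.1). [folklore] -/
inductive Conf
  /-- kernel-theorem / certificate-backed -/
  | certified
  /-- calibrated pipeline inside its calibration domain -/
  | screening
  /-- outside a calibration domain / model extension -/
  | extrapolated
  deriving DecidableEq, Repr

/-- A cell after scoring: its class, its word, and the truth word derived from the curated column. [folklore] -/
structure ScoredCell where
  /-- confidence class (ignored for undetermined words) -/
  conf : Conf
  /-- the map's word -/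
  w : Word
  /-- the truth word at (T, P, H) -/
  t : Truth
  deriving DecidableEq, Repr

/-- The cell's §4.3 outcome. [folklore] -/
def ScoredCell.out (x : ScoredCell) : Outcome := outcome x.w x.t

/-- number of cells of class `c` with outcome `o`. [folklore] -/
def nOut (c : Conf) (o : Outcome) : List ScoredCell → ℕ
  | [] => 0
  | x :: xs => (if x.conf = c ∧ x.out = o then 1 else 0) + nOut c o xs

/-- §4.3 per-class accuracy tally: agree / (agree + disagree) among cells of class `c` (unscored and abstaining cells excluded from
both). [folklore] -/
def acc (c : Conf) (cells : List ScoredCell) : Tally := ⟨nOut c .agree cells, nOut c .agree cells + nOut c .disagree cells⟩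

/-- §4.1 H1, cell part: some CERTIFIED cell disagrees with truth (outside tolerance — the tolerance is inside `Truth`). [folklore] -/
def h1 (cells : List ScoredCell) : Bool := decide (0 < nOut .certified .disagree cells)

/-- `nOut` on a cons. [folklore] -/
theorem nOut_cons (c : Conf) (o : Outcome) (x : ScoredCell) (xs : List ScoredCell) :
    nOut c o (x :: xs) = (if x.conf = c ∧ x.out = o then 1 else 0) + nOut c o xs := rfl

/-- `nOut` is positive iff some cell of that class has that outcome. [folklore] -/
theorem nOut_pos_iff (c : Conf) (o : Outcome) (cells : List ScoredCell) :
    0 < nOut c o cells ↔ ∃ x ∈ cells, x.conf = c ∧ x.out = o := by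
  induction cells with
  | nil => simp [nOut]
  | cons y ys ih =>
    simp only [nOut_cons, List.exists_mem_cons_iff]
    by_cases hy : y.conf = c ∧ y.out = o
    · simp [hy]
    · simp [hy, ih]

/-! ## §2 The certified accuracy tally is binary -/

/-- accuracy(certified) MEETS 1.00 iff there is no certified disagreement (h1 = false). [folklore] -/
theorem acc_certified_meets_one_iff (cells : List ScoredCell) :
    (acc .certified cells).meets 1 = true ↔ h1 cells = false := by
  rw [Tally.meets_eq_true_iff]
  simp only [acc, h1, Nat.cast_add, one_mul, decide_eq_false_iff_not, not_lt, Nat.le_zero]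
  constructor
  · intro h
    have : (nOut .certified .disagree cells : ℚ) ≤ 0 := by linarith
    exact_mod_cast Nat.le_zero.mp (by exact_mod_cast this)
  · intro h; simp [h]

/-- accuracy(certified) is NOT APPLICABLE (prints n/a) iff no certified cell is decided against known truth. [folklore] -/
theorem acc_certified_applicable_false_iff (cells : List ScoredCell) :
    (acc .certified cells).applicable = false ↔ nOut .certified .agree cells = 0 ∧ nOut .certified .disagree cells = 0 := by
  simp only [Tally.applicable, acc, decide_eq_false_iff_not, not_lt]
  omega

/-! ## §3 The interlock with the §7 verdict -/

/-- An H1 incident makes the rung-1 verdict FAIL whatever the clause statuses (and whatever other incident flags are or-ed in).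
[folklore] -/
theorem rung1_eq_FAIL_of_h1 (cells : List ScoredCell) (other : Bool) (cs : List ClauseStatus) (h : h1 cells = true) :
    rung1 (h1 cells || other) cs = .FAIL := by
  rw [rung1_eq_FAIL_iff]; simp [h]

/-- THE SENTENCE «must be 1.00»: in a run whose verdict is not FAIL, accuracy(certified) is NA or meets 1.00 — a value below one can only
ever be printed on a FAIL line. [folklore] -/
theorem acc_certified_of_ne_FAIL (cells : List ScoredCell) (other : Bool) (cs : List ClauseStatus)
    (hv : rung1 (h1 cells || other) cs ≠ .FAIL) :
    (acc .certified cells).applicable = false ∨ (acc .certified cells).meets 1 = true := by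
  right
  rw [acc_certified_meets_one_iff]
  by_contra hc
  rw [Bool.not_eq_false] at hc
  exact hv (rung1_eq_FAIL_of_h1 cells other cs hc)

/-- Conversely, WITHOUT an incident the certified tally meets every floor θ ≤ 1 it could be asked (it is all-agree). [folklore] -/
theorem acc_certified_meets_of_not_h1 (cells : List ScoredCell) (θ : ℚ) (hθ : θ ≤ 1) (h : h1 cells = false) :
    (acc .certified cells).meets θ = true := by
  have hd : nOut .certified .disagree cells = 0 := by
    simp only [h1, decide_eq_false_iff_not, not_lt, Nat.le_zero] at h; exact h
  rw [Tally.meets_eq_true_iff]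
  simp only [acc, hd, Nat.add_zero]
  have : (0 : ℚ) ≤ nOut .certified .agree cells := by exact_mod_cast Nat.zero_le _
  nlinarith

/-! ## §4 Contrast: screening-grade accuracy is an ordinary ratio; abstentions move nothing -/

/-- A screening-grade disagreement is no incident: one screening cell «not» on an SC truth point gives accuracy(screening) 0/1 and
h1 = false. [folklore] -/
theorem screening_disagree_no_incident :
    let cells := [ScoredCell.mk .screening .not .SC]
    h1 cells = false ∧ acc .screening cells = ⟨0, 1⟩ ∧ (acc .screening cells).meets (4 / 5) = false := by
  refine ⟨by decide, by decide, ?_⟩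
  have : acc .screening [ScoredCell.mk .screening .not .SC] = ⟨0, 1⟩ := by decide
  rw [this, Tally.meets_eq_false_iff]; norm_num

/-- … whereas the same disagreement at certified class IS an incident and the verdict is FAIL for any clause table. [folklore] -/
theorem certified_disagree_incident (cs : List ClauseStatus) :
    h1 [ScoredCell.mk .certified .not .SC] = true ∧ rung1 (h1 [ScoredCell.mk .certified .not .SC] || false) cs = .FAIL := by
  have h : h1 [ScoredCell.mk .certified .not .SC] = true := by decide
  exact ⟨h, rung1_eq_FAIL_of_h1 _ false cs h⟩

/-- An undetermined cell (any class label, any truth) moves no accuracy tally: «counted, never scored as a miss». [folklore] -/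
theorem acc_cons_undetermined (c c' : Conf) (t : Truth) (cells : List ScoredCell) :
    acc c (ScoredCell.mk c' .undetermined t :: cells) = acc c cells := by
  have ho : (ScoredCell.mk c' Word.undetermined t).out = .abstain := outcome_undetermined t
  simp [acc, nOut_cons, ho]

/-- Nor does a decided cell on an UNKNOWN truth point (inside the tolerance band): outcome unscored. [folklore] -/
theorem acc_cons_unknown (c c' : Conf) (w : Word) (cells : List ScoredCell) :
    acc c (ScoredCell.mk c' w .unknown :: cells) = acc c cells := by
  cases w <;> simp [acc, nOut_cons, ScoredCell.out, outcome]

/-! ## §5 Numbers of record: run #6 (maps run-2026-08-27a), v1 table, both engines -/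

/-- Run #6 v1 table: zero certified decided cells ⇒ accuracy(certified) NA («acc cert n/a (n 0)»; the PASS(vacuous) component of
§7), 57 screening-grade cells all agreeing ⇒ accuracy(screening-grade) 57/57 meets the 0.80 floor; no incident. Modelled by a list
of 57 agreeing screening cells. [folklore] -/
theorem run6_v1_accuracy :
    let cells := List.replicate 57 (ScoredCell.mk .screening .SC .SC)
    (acc .certified cells).applicable = false ∧ acc .screening cells = ⟨57, 57⟩ ∧
      (acc .screening cells).meets (4 / 5) = true ∧ h1 cells = false := by
  refine ⟨by decide, by decide, ?_, by decide⟩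
  have : acc .screening (List.replicate 57 (ScoredCell.mk .screening .SC .SC)) = ⟨57, 57⟩ := by decide
  rw [this, Tally.meets_eq_true_iff]; norm_num

end CellScore

end Summit.Ventures.CertifiedManyBodySolver.Downfold
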